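import Literature.NumberTheory.PAdicHodge.BmaxPlusTransportedReciprocity
import Literature.NumberTheory.PAdicHodge.AinfRamifiedTransportedPeriodsTheta
import Literature.NumberTheory.PAdicHodge.TatePairingPointOfKTwoCanonical
import Literature.NumberTheory.PAdicHodge.BmaxPlusFormalLogDivisionTowerElliptic
import HarnessLib

/-!
# Inputs of the capstone for the TRANSPORTED pair of a ramified good model `W_D ≡ E₀ (mod ϖ)`: `Pω″ ⊆ Fil¹` from the Hodge line,
# the branch (`Pη″ = P⁰` or `Q⁰`, with `hne`/`hnot`), and the per-point Kummer data along the canonical matching ((K₂) discharged)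

Topic `Literature/NumberTheory/PAdicHodge`; THEOREMS ONLY (no definition, no named fact, no instance, no `sorry`). Sequel of
`BmaxPlusTransportedReciprocity` (the socket capstone with the recombined transported Hodge pair `Pω″ = ι(A)P⁰ + ι(B)Q⁰`, `Pη″ = ι(C)P⁰ + ι(C′)Q⁰`
along an abstract matching, modulo (K₂) in the transported `c_L`-free crystalline form); here its remaining hypotheses are DISCHARGED for the good
supersingular `𝒪_D`-model `E = curveFO F (W_D ⊗_ψ 𝒪_F)` — everything except the Hodge line itself and `hne` in branch (a). Brick T5 of memos
`Summits/BirchSwinnertonDyer/BirchSwinnertonDyer/Cruxes/StarredOptimalManinUnitFiveSeven/Lines/kato-lever-K2-transported-period-hom.md` §2/§6 and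
`…/kato-lever-K2-ramified-cm-transport.md` §10.2 (line `kato_lever`, crux K★ `stmt-BirchSwinnertonDyer-22226`).

* §1 `thetaBdR_transported_hodgePair_eq_zero` — **`θ(ι(A)·P⁰τ + ι(B)·Q⁰τ) = 0` for every `τ ∈ T_pŴ_D`** (so `Pω″ ⊆ Fil¹ = ker θ`): the torsion tower
  `seqO τ` has a CM-fibre transport and a witness, `P⁰τ`, `Q⁰τ` are `f Λ_N`, `f φΛ_N` of it (`hLT`), and T2c
  (`AinfRamTop.thetaBdR_transportedHodgeCombination_eq_zero_of_torsion`) applies with the power-series Hodge line `(A, B, d)`.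
* §2 ★ `exists_transported_etaPartner` — **THE BRANCH.** Given the Hodge line with `(A, B) ≠ 0`, a nonzero `τ₀ ∈ T_pŴ_D`, `E₀` good supersingular at
  `p ≥ 5`, and `hne` in branch (a) (`(∃ τ, θ(P⁰τ) ≠ 0) → ι(A)P⁰ + ι(B)Q⁰ ≢ 0`): there are scalars `C, C′` and honest maps `Pω″ = ι(A)P⁰ + ι(B)Q⁰`,
  `Pη″ = ι(C)P⁰ + ι(C′)Q⁰` with `Pω″ ⊆ Fil¹`, `Pω″ ≢ 0`, `Pη″ ⊄ Fil¹` — branch (a) `Pη″ = P⁰`; branch (b) (`θ∘P⁰ ≡ 0`): non-degeneracy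
  (`thetaBmaxPlus_frobBmaxPlus_logSum_transport_ne_zero`) gives `θ(Q⁰τ₀) ≠ 0`, hence `B = 0`, `A ≠ 0`, `Pη″ = Q⁰`, and `Pω″τ₀ = ι(A)P⁰τ₀ ≠ 0`
  (`transported_P₀_ne_zero`).
* §3 ★★ `exists_transported_kummer_data` — **the per-point data along the CANONICAL matching `em = θ_∞ ≫ tateGeomEquivTatePtOSS`**: for `P ∈ E(F)`
  with a `p`-power division sequence `Q` (`Q₀ = P`) whose base is a formal point with `‖z(P)‖^N ≤ ‖p‖`, and `c_P` with `ι(c_P) = p^N·Σ'[Xʲ]log_{W_D}·z(P)ʲ`: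
  a cocycle `κ` WITH the level Kummer classes of `P` (`LocalTatePairingKummerTadic`), the transported crystalline integrating pair
  `(b⁰_ω, b⁰_η) = (f Λ_{Tu}, f φΛ_{Tu})` of `(P⁰∘em∘κ, Q⁰∘em∘κ)` (`em_tadicKummer_eq_kummerCocycleO` + `transported_integrating_pair` on the CM-fibre
  transport `Tu` of the Kummer tower `u = z(Q)`), `θ(ι(A)b⁰_ω + ι(B)b⁰_η) = ι(c_P)` (`AinfRamTop.thetaBdR_transportedHodgeCombination_eq`), and
  **(K₂) for EVERY `a ∈ T_pE`**: `∃ M, IsTeichLog 2 (p^M·(Q⁰(em a)·b⁰_ω − P⁰(em a)·b⁰_η))` (`isTeichLog_transported_resolution` with the Dieudonné–Honda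
  relation of `Λ_{Tu}`) — literally the per-point hypotheses of `exists_const_tatePairingPoint_eq_neg_trace_of_KTwo_transported_of_matching`.

HONEST LIMITS: infrastructure for [REC] at the deep formal points of one ramified good supersingular model; BSD / K★ (`stmt-BirchSwinnertonDyer-22226`) /
[REC-tower] are NOT proved by this file.

## References
* K. Kato, LNM 1553 (1993), Ch. II Thm. 1.4.1, Lemma 1.4.3. [Kato1993LNM1553]
* S. Bloch, K. Kato (1990), Ex. 3.10.1, Example 3.11. [BlochKato1990]
* P. Colmez, Math. Ann. 292 (1992), §2. [Colmez1992PeriodesAbeliennes]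
* N. M. Katz, *Crystalline cohomology, Dieudonné modules, and Jacobi sums* (1981), Thm. 5.1.4–5.1.5. [Katz1981CrystallineDieudonne]
* J. H. Silverman, *AEC* (2009), Prop. VII.2.1–VII.2.2, VIII §2. [SilvermanAEC2009]
-/

noncomputable section

open Field Function ValuativeRel WittVector NumberField IsDedekindDomain
open scoped NumberField Topology

namespace Literature.NumberTheory.PAdicHodge

open Literature.NumberTheory.GaloisRepresentations
open Literature.NumberTheory.GaloisRepresentations.IsNonarchimedeanLocalField
open Literature.NumberTheory.GaloisRepresentations.LubinTate
open Literature.NumberTheory.GaloisCohomology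
open Literature.NumberTheory.EllipticCurves
open Literature.NumberTheory.EllipticCurves.FormalGroupChart
open Literature.NumberTheory.PAdicHodge.GaloisContinuity
open Literature.IUT.LogVolume
open Literature.RingTheory.FormalGroups Literature.AlgebraicGeometry.Resolution
open _root_.WeierstrassCurve

/-! ### §1–§2 `Pω″ ⊆ Fil¹` and the branch (any `p`-adic field `F` with `θ` onto) -/

section Branch

variable {F : Type} [Field F] [ValuativeRel F] [TopologicalSpace F] [IsNonarchimedeanLocalField F] [CharZero F]
  {p : ℕ} [hpp : Fact p.Prime] [Fact (¬ IsUnit (p : integerC F))] [IsAdicComplete (Ideal.span {(p : integerC F)}) (integerC F)]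
  (hp : valuation F p < 1) (D : EisensteinRoot F p hp) [CharZero (CompletedAlgClosure F)]
  (W : WeierstrassCurve (EisensteinRoot.CoeffDisc D)) (E₀ : WeierstrassCurve ℤ)
  (hWE : W.map (Ideal.Quotient.mk (Ideal.span {EisensteinRoot.CoeffDisc.of D (AdjoinRoot.root D.poly)})) =
    (E₀.map (algebraMap ℤ (EisensteinRoot.CoeffDisc D))).map
      (Ideal.Quotient.mk (Ideal.span {EisensteinRoot.CoeffDisc.of D (AdjoinRoot.root D.poly)})))
  (ψ : EisensteinRoot.CoeffDisc D →+* LTCoeff F) (hψ : ∀ c, algebraMap (LTCoeff F) F (ψ c) = EisensteinRoot.CoeffDisc.toF D c)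
  {N : ℕ} (hN : D.e ≤ N) {LT : AinfTop.TatePtO F (W.map ψ) p →+ BmaxPlus F p} {P₀ Q₀ : AinfTop.TatePtO F (W.map ψ) p →+ BdRPlusTop F p}
  (hLT : ∀ (τ : AinfTop.TatePtO F (W.map ψ) p) (w : ℕ → (maxNilIdealC F).toIdeal) (hw : ∀ n, AinfTop.mulPC F p E₀ (w (n + 1)) = w n)
      (_ : ∀ n, ‖(((w n : (maxNilIdealC F).toIdeal) : CBall F) : CompletedAlgClosure F) -
    (((AinfTop.seqO (W.map ψ) τ n : (maxNilIdealC F).toIdeal) : CBall F) : CompletedAlgClosure F)‖ ≤ ‖((D.rootC : integerC F) : CompletedAlgClosure F)‖)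
      (z : bmaxZero F p), algebraMap (Ainf (p := p) F) (bmaxZero F p)
      ((AinfTop.of F p).symm (((AinfTop.divisionLiftPt E₀ (surjective_fontaineTheta_integerC hp) w hw).val :
        (AinfTop.nilTheta F p (surjective_fontaineTheta_integerC hp)).toIdeal) : AinfTop F p)) ^ N = (p : bmaxZero F p) * z →
      LT τ = PadicLogSeries.logSum ((algebraMap (Ainf (p := p) F) (bmaxZero F p)).comp zpToAinf) (GaloisContinuity.formalLogNum E₀ p) N
        (algebraMap (Ainf (p := p) F) (bmaxZero F p)
          ((AinfTop.of F p).symm (((AinfTop.divisionLiftPt E₀ (surjective_fontaineTheta_integerC hp) w hw).val :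
            (AinfTop.nilTheta F p (surjective_fontaineTheta_integerC hp)).toIdeal) : AinfTop F p))) z)
  (hP₀ : ∀ τ, P₀ τ = BdRPlusTop.of F p (bmaxPlusToBdR F p (LT τ)))
  (hQ₀ : ∀ τ, Q₀ τ = BdRPlusTop.of F p (bmaxPlusToBdR F p (frobBmaxPlus F p (LT τ))))
  (A B : F) (dHL : ℕ)
  (hHL : ∀ n : ℕ, ‖(p : CompletedAlgClosure F) ^ dHL * PowerSeries.coeff n
      ((W.map ((CBall F).subtype.comp (EisensteinRoot.CoeffDisc.toCBall D))).formalLog -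
        PowerSeries.C (algebraMap F (CompletedAlgClosure F) A) * (E₀.map (Int.castRingHom (CompletedAlgClosure F))).formalLog -
        PowerSeries.C (algebraMap F (CompletedAlgClosure F) B) *
          PowerSeries.expand p hpp.out.ne_zero (E₀.map (Int.castRingHom (CompletedAlgClosure F))).formalLog)‖ ≤ 1)

include hWE hψ hN hLT hP₀ hQ₀ hHL in
set_option maxHeartbeats 1600000 in
/-- **`θ(ι(A)·P⁰τ + ι(B)·Q⁰τ) = 0` on the whole Tate module** (`Pω″ ⊆ Fil¹`): transport the torsion tower `seqO τ` (`exists_unique_transport_seqO`),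
take a witness (`exists_witness_transport`), read `P⁰τ, Q⁰τ` through `hLT`, and apply T2c on torsion towers
(`AinfRamTop.thetaBdR_transportedHodgeCombination_eq_zero_of_torsion`). [cite: Katz1981CrystallineDieudonne, Thm. 5.1.4–5.1.5]
[cite: Colmez1992PeriodesAbeliennes, §2] -/
theorem thetaBdR_transported_hodgePair_eq_zero (τ : AinfTop.TatePtO F (W.map ψ) p) :
    thetaBdR ((BdRPlusTop.of F p).symm (BdRPlusTop.of F p (embBdRHom hp (surjective_fontaineTheta_integerC hp) A) * P₀ τ +
      BdRPlusTop.of F p (embBdRHom hp (surjective_fontaineTheta_integerC hp) B) * Q₀ τ)) = 0 := by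
  obtain ⟨w, ⟨hw, hwv⟩, -⟩ := exists_unique_transport_seqO D W E₀ hWE ψ hψ τ
  obtain ⟨z, hz⟩ := exists_witness_transport D W E₀ ψ τ hw hwv hN (hθ := surjective_fontaineTheta_integerC hp)
  have hu0 : (((AinfTop.seqO (W.map ψ) τ 0 : (maxNilIdealC F).toIdeal) : CBall F) : CompletedAlgClosure F) = 0 := by
    rw [AinfTop.seqO_zero, ZeroMemClass.coe_zero]
  rw [hP₀, hQ₀, hLT τ w hw hwv z hz, map_add, map_mul, map_mul, RingEquiv.symm_apply_apply, RingEquiv.symm_apply_apply,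
    RingEquiv.symm_apply_apply, RingEquiv.symm_apply_apply]
  exact AinfRamTop.thetaBdR_transportedHodgeCombination_eq_zero_of_torsion D (hθ := surjective_fontaineTheta_integerC hp) W E₀ A B dHL
    hHL (AinfTop.seqO (W.map ψ) τ) w (AinfRamTop.mulPC_seqO W ψ hψ τ) hu0 hw hwv (D.e_pos.trans_le hN) hz

include hWE hψ hN hLT hP₀ hQ₀ hHL in
set_option maxHeartbeats 3200000 in
/-- ★ **THE BRANCH: the `η`-partner of the transported Hodge pair.** `E₀` good supersingular at `p ≥ 5` (`p ∤ Δ(E₀)`, Hasse `0`; fibres and `E₀ ⊗ ℂ_F`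
elliptic), Hodge line `(A, B, d)` with `(A, B) ≠ 0`, some `τ₀ ≠ 0` in `T_pŴ_D`, and `hne` in branch (a). Then there are `C, C′ ∈ F` and honest maps
`Pω″, Pη″ : T_pŴ_D →+ B_dR⁺` with `Pω″ = ι(A)P⁰ + ι(B)Q⁰ ⊆ Fil¹`, `Pω″ ≢ 0`, `Pη″ = ι(C)P⁰ + ι(C′)Q⁰ ⊄ Fil¹`:
branch (a) (`θ(P⁰τ₁) ≠ 0` for some `τ₁`): `Pη″ := P⁰`; branch (b) (`θ∘P⁰ ≡ 0`): `θ(Q⁰τ₀) ≠ 0` by non-degeneracy, so `B = 0 ≠ A`, `Pη″ := Q⁰`,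
`Pω″τ₀ = ι(A)·P⁰τ₀ ≠ 0`. [cite: Kato1993LNM1553, Ch. II §1.4] [cite: Colmez1992PeriodesAbeliennes, §2] [cite: Katz1981CrystallineDieudonne, Thm. 5.1.5] -/
theorem exists_transported_etaPartner (hp5 : 5 ≤ p) (hΔ₀ : ¬ (p : ℤ) ∣ E₀.Δ) (hA₀ : (E₀.map (Int.castRingHom (ZMod p))).hasseCoeff p = 0)
    [(E₀.map (Int.castRingHom ℚ_[p])).IsElliptic] [(E₀.map (Int.castRingHom (ZMod p))).IsElliptic]
    [(curveOver (CompletedAlgClosure F) E₀).IsElliptic] (hAB : A ≠ 0 ∨ B ≠ 0)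
    (hex : ∃ τ₀ : AinfTop.TatePtO F (W.map ψ) p, τ₀ ≠ 0)
    (hne_a : (∃ τ, thetaBdR ((BdRPlusTop.of F p).symm (P₀ τ)) ≠ 0) →
      ∃ τ, BdRPlusTop.of F p (embBdRHom hp (surjective_fontaineTheta_integerC hp) A) * P₀ τ +
        BdRPlusTop.of F p (embBdRHom hp (surjective_fontaineTheta_integerC hp) B) * Q₀ τ ≠ 0) :
    ∃ (C C' : F) (Pω Pη : AinfTop.TatePtO F (W.map ψ) p →+ BdRPlusTop F p),
      (∀ τ, Pω τ = BdRPlusTop.of F p (embBdRHom hp (surjective_fontaineTheta_integerC hp) A) * P₀ τ +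
        BdRPlusTop.of F p (embBdRHom hp (surjective_fontaineTheta_integerC hp) B) * Q₀ τ) ∧
      (∀ τ, Pη τ = BdRPlusTop.of F p (embBdRHom hp (surjective_fontaineTheta_integerC hp) C) * P₀ τ +
        BdRPlusTop.of F p (embBdRHom hp (surjective_fontaineTheta_integerC hp) C') * Q₀ τ) ∧
      (∀ τ, Pω τ ∈ (BdRPlusTop.filOne F p).toIdeal) ∧ (∃ τ, Pω τ ≠ 0) ∧ (∃ τ, Pη τ ∉ (BdRPlusTop.filOne F p).toIdeal) := by
  obtain ⟨ιA, hιA⟩ : ∃ x : BdRPlusTop F p, x = BdRPlusTop.of F p (embBdRHom hp (surjective_fontaineTheta_integerC hp) A) := ⟨_, rfl⟩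
  obtain ⟨ιB, hιB⟩ : ∃ x : BdRPlusTop F p, x = BdRPlusTop.of F p (embBdRHom hp (surjective_fontaineTheta_integerC hp) B) := ⟨_, rfl⟩
  obtain ⟨Pω, hPω⟩ : ∃ Pω' : AinfTop.TatePtO F (W.map ψ) p →+ BdRPlusTop F p, ∀ τ, Pω' τ = ιA * P₀ τ + ιB * Q₀ τ :=
    ⟨(AddMonoidHom.mulLeft ιA).comp P₀ + (AddMonoidHom.mulLeft ιB).comp Q₀, fun _ => rfl⟩
  have hθω : ∀ τ, thetaBdR ((BdRPlusTop.of F p).symm (Pω τ)) = 0 := fun τ => by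
    rw [hPω, hιA, hιB]; exact thetaBdR_transported_hodgePair_eq_zero hp D W E₀ hWE ψ hψ hN hLT hP₀ hQ₀ A B dHL hHL τ
  have hfil : ∀ τ, Pω τ ∈ (BdRPlusTop.filOne F p).toIdeal := fun τ => by
    rw [BdRPlusTop.mem_filOne_iff, ← mem_ker_thetaBdR_iff]; exact hθω τ
  have hHLθ := thetaBdR_hodgeLine_of_filOne hp (surjective_fontaineTheta_integerC hp) P₀ Q₀ Pω A B (fun τ => by rw [hPω, hιA, hιB]) hfil
  obtain ⟨τ₀, hτ₀⟩ := hex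
  obtain ⟨w₀, ⟨hw₀, hwv₀⟩, -⟩ := exists_unique_transport_seqO D W E₀ hWE ψ hψ τ₀
  obtain ⟨z₀, hz₀⟩ := exists_witness_transport D W E₀ ψ τ₀ hw₀ hwv₀ hN (hθ := surjective_fontaineTheta_integerC hp)
  haveI := isDomain_bDeRhamPlus (F := F) (p := p) (surjective_fontaineTheta_integerC hp)
  haveI : IsDomain (BdRPlusTop F p) := isDomain_bDeRhamPlus (F := F) (p := p) (surjective_fontaineTheta_integerC hp)
  by_cases hcase : ∃ τ, thetaBdR ((BdRPlusTop.of F p).symm (P₀ τ)) ≠ 0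
  · -- branch (a): `Pη″ := P⁰`
    obtain ⟨τ₁, hτ₁⟩ := hcase
    obtain ⟨τ, hτ⟩ := hne_a ⟨τ₁, hτ₁⟩
    refine ⟨1, 0, Pω, P₀, fun τ => by rw [hPω, hιA, hιB], fun τ => ?_, hfil, ⟨τ, by rw [hPω, hιA, hιB]; exact hτ⟩, ⟨τ₁, ?_⟩⟩
    · rw [map_one, map_one, map_zero, map_zero, one_mul, zero_mul, add_zero]
    · rw [BdRPlusTop.mem_filOne_iff, ← mem_ker_thetaBdR_iff]; exact hτ₁
  · -- branch (b): `θ ∘ P⁰ ≡ 0`, hence `B = 0`, `Pη″ := Q⁰`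
    push Not at hcase
    have hθQ₀ : thetaBdR ((BdRPlusTop.of F p).symm (Q₀ τ₀)) ≠ 0 := by
      have h1 : thetaBmaxPlus F p (LT τ₀) = 0 := by
        have h := hcase τ₀
        rw [hP₀, RingEquiv.symm_apply_apply, thetaBdR_bmaxPlusToBdR] at h
        exact Subtype.ext (by rw [h]; rfl)
      rw [hQ₀, RingEquiv.symm_apply_apply, thetaBdR_bmaxPlusToBdR]
      rw [hLT τ₀ w₀ hw₀ hwv₀ z₀ hz₀] at h1 ⊢
      have h2 := thetaBmaxPlus_frobBmaxPlus_logSum_transport_ne_zero D W E₀ ψ hψ (hθ := surjective_fontaineTheta_integerC hp)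
        hp hp5 hΔ₀ hA₀ τ₀ hτ₀ hw₀ hwv₀ hN hz₀ h1
      exact fun h => h2 (Subtype.ext (by rw [h]; rfl))
    have hB0 : B = 0 := by
      have h := hHLθ τ₀
      rw [hcase τ₀, mul_zero, zero_add, mul_eq_zero] at h
      rcases h with h | h
      · exact (algebraMap F (CompletedAlgClosure F)).injective (by rw [h, map_zero])
      · exact absurd h hθQ₀
    have hA0 : A ≠ 0 := by
      rcases hAB with h | h
      · exact h
      · exact absurd hB0 h
    refine ⟨0, 1, Pω, Q₀, fun τ => by rw [hPω, hιA, hιB], fun τ => ?_, hfil, ⟨τ₀, ?_⟩, ⟨τ₀, ?_⟩⟩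
    · rw [map_one, map_one, map_zero, map_zero, one_mul, zero_mul, zero_add]
    · rw [hPω, hιB, hB0, map_zero, map_zero, zero_mul, add_zero, hιA]
      refine mul_ne_zero ?_ (transported_P₀_ne_zero D W E₀ hWE ψ hψ (hθ := surjective_fontaineTheta_integerC hp) hp hp5 hΔ₀ hA₀
        hN hLT hP₀ τ₀ hτ₀)
      rw [Ne, map_eq_zero_iff _ (BdRPlusTop.of F p).injective, map_eq_zero_iff _ (embBdRHom_injective hp (surjective_fontaineTheta_integerC hp))]
      exact hA0
    · rw [BdRPlusTop.mem_filOne_iff, ← mem_ker_thetaBdR_iff]; exact hθQ₀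

end Branch

/-! ### §3 The per-point Kummer data along the canonical matching (`F = K_v`) -/

section Completion

variable {K : Type} [Field K] [NumberField K] {p : ℕ} [hprime : Fact p.Prime] (v : HeightOneSpectrum (𝓞 K))
  [CharZero (v.adicCompletion K)]
  [Fact (¬ IsUnit (p : integerC (v.adicCompletion K)))]
  [IsAdicComplete (Ideal.span {(p : integerC (v.adicCompletion K))}) (integerC (v.adicCompletion K))]
  [CharP 𝓀[v.adicCompletion K] p] [CharZero (CompletedAlgClosure (v.adicCompletion K))]
  (hpv : valuation (v.adicCompletion K) (p : v.adicCompletion K) < 1)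
  (Dv : EisensteinRoot (v.adicCompletion K) p hpv) (Wm : WeierstrassCurve (EisensteinRoot.CoeffDisc Dv))
  (ψm : EisensteinRoot.CoeffDisc Dv →+* LTCoeff (v.adicCompletion K))
  (hψm : ∀ c, algebraMap (LTCoeff (v.adicCompletion K)) (v.adicCompletion K) (ψm c) = EisensteinRoot.CoeffDisc.toF Dv c)
  (hp2 : p ≠ 2) (hΔ : IsUnit (Wm.map ψm).Δ) (hA : ((Wm.map ψm).map (AinfTop.redCoeff (v.adicCompletion K))).hasseCoeff p = 0)
  [(AinfTop.curveFO (v.adicCompletion K) (Wm.map ψm)).IsElliptic]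
  [(curveOver (CompletedAlgClosure (v.adicCompletion K)) (Wm.map ψm)).IsElliptic]

set_option maxHeartbeats 4800000 in
include hψm in
/-- ★★ **The per-point Kummer data of a deep formal point, along the canonical matching `em = θ_∞ ≫ tateGeomEquivTatePtOSS`, with (K₂) PROVED.**
Setting: good supersingular `𝒪_D`-model `E = curveFO F (W_D ⊗_ψ 𝒪_F)` congruent mod `ϖ` to `E₀/ℤ` (`E₀ ⊗ ℚ_p`, `E₀ ⊗ 𝔽_p` elliptic), transported period maps
`(LT, P⁰, Q⁰)` at index `N ≥ e` (`hLT hP₀ hQ₀`), Hodge line `(A, B, d)`. For `P ∈ E(F)` with a `p`-power division sequence `Q` (`Q₀ = P`) whose base is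
a formal point with `‖z(P)‖^N ≤ ‖p‖`, and `c_P ∈ F` with `ι(c_P) = p^N·Σ'[Xʲ]log_{W_D}·z(P)ʲ`, there are a cocycle `κ` carrying the level Kummer classes
of `P` and `b⁰_ω, b⁰_η ∈ B_dR⁺` with: `P⁰(em(κ τ)) = τb⁰_ω − b⁰_ω`, `Q⁰(em(κ τ)) = τb⁰_η − b⁰_η`, `θ(ι(A)b⁰_ω + ι(B)b⁰_η) = ι(c_P)`, and
**for every `a ∈ T_pE`: `∃ M, IsTeichLog 2 (p^M·(Q⁰(em a)·b⁰_ω − P⁰(em a)·b⁰_η))`** — `(b⁰_ω, b⁰_η) = (f Λ_{Tu}, f φΛ_{Tu})` for the CM-fibre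
transport `Tu` of the Kummer tower `u = z(Q)`. [cite: Kato1993LNM1553, Ch. II Lemma 1.4.3] [cite: BlochKato1990, Ex. 3.10.1, Example 3.11]
[cite: Katz1981CrystallineDieudonne, Thm. 5.1.4–5.1.5] [cite: SilvermanAEC2009, Prop. VII.2.2 and VIII §2] -/
theorem exists_transported_kummer_data (E₀ : WeierstrassCurve ℤ)
    (hWE : Wm.map (Ideal.Quotient.mk (Ideal.span {EisensteinRoot.CoeffDisc.of Dv (AdjoinRoot.root Dv.poly)})) =
      (E₀.map (algebraMap ℤ (EisensteinRoot.CoeffDisc Dv))).map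
        (Ideal.Quotient.mk (Ideal.span {EisensteinRoot.CoeffDisc.of Dv (AdjoinRoot.root Dv.poly)})))
    [(E₀.map (Int.castRingHom ℚ_[p])).IsElliptic] [(E₀.map (Int.castRingHom (ZMod p))).IsElliptic]
    {N : ℕ} (hN : Dv.e ≤ N) {LT : AinfTop.TatePtO (v.adicCompletion K) (Wm.map ψm) p →+ BmaxPlus (v.adicCompletion K) p}
    {P₀ Q₀ : AinfTop.TatePtO (v.adicCompletion K) (Wm.map ψm) p →+ BdRPlusTop (v.adicCompletion K) p}
    (hLT : ∀ (τ : AinfTop.TatePtO (v.adicCompletion K) (Wm.map ψm) p) (w : ℕ → (maxNilIdealC (v.adicCompletion K)).toIdeal)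
        (hw : ∀ n, AinfTop.mulPC (v.adicCompletion K) p E₀ (w (n + 1)) = w n)
        (_ : ∀ n, ‖(((w n : (maxNilIdealC (v.adicCompletion K)).toIdeal) : CBall (v.adicCompletion K)) : CompletedAlgClosure (v.adicCompletion K)) -
          (((AinfTop.seqO (Wm.map ψm) τ n : (maxNilIdealC (v.adicCompletion K)).toIdeal) : CBall (v.adicCompletion K)) :
            CompletedAlgClosure (v.adicCompletion K))‖ ≤
          ‖((Dv.rootC : integerC (v.adicCompletion K)) : CompletedAlgClosure (v.adicCompletion K))‖)
        (z : bmaxZero (v.adicCompletion K) p), algebraMap (Ainf (p := p) (v.adicCompletion K)) (bmaxZero (v.adicCompletion K) p)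
          ((AinfTop.of (v.adicCompletion K) p).symm (((AinfTop.divisionLiftPt E₀ (surjective_fontaineTheta_integerC hpv) w hw).val :
            (AinfTop.nilTheta (v.adicCompletion K) p (surjective_fontaineTheta_integerC hpv)).toIdeal) : AinfTop (v.adicCompletion K) p)) ^ N =
          (p : bmaxZero (v.adicCompletion K) p) * z →
        LT τ = PadicLogSeries.logSum ((algebraMap (Ainf (p := p) (v.adicCompletion K)) (bmaxZero (v.adicCompletion K) p)).comp zpToAinf)
          (GaloisContinuity.formalLogNum E₀ p) N
          (algebraMap (Ainf (p := p) (v.adicCompletion K)) (bmaxZero (v.adicCompletion K) p)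
            ((AinfTop.of (v.adicCompletion K) p).symm (((AinfTop.divisionLiftPt E₀ (surjective_fontaineTheta_integerC hpv) w hw).val :
              (AinfTop.nilTheta (v.adicCompletion K) p (surjective_fontaineTheta_integerC hpv)).toIdeal) : AinfTop (v.adicCompletion K) p))) z)
    (hP₀ : ∀ τ, P₀ τ = BdRPlusTop.of (v.adicCompletion K) p (bmaxPlusToBdR (v.adicCompletion K) p (LT τ)))
    (hQ₀ : ∀ τ, Q₀ τ = BdRPlusTop.of (v.adicCompletion K) p (bmaxPlusToBdR (v.adicCompletion K) p (frobBmaxPlus (v.adicCompletion K) p (LT τ))))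
    (A B : v.adicCompletion K) (dHL : ℕ)
    (hHL : ∀ n : ℕ, ‖(p : CompletedAlgClosure (v.adicCompletion K)) ^ dHL * PowerSeries.coeff n
        ((Wm.map ((CBall (v.adicCompletion K)).subtype.comp (EisensteinRoot.CoeffDisc.toCBall Dv))).formalLog -
          PowerSeries.C (algebraMap (v.adicCompletion K) (CompletedAlgClosure (v.adicCompletion K)) A) *
            (E₀.map (Int.castRingHom (CompletedAlgClosure (v.adicCompletion K)))).formalLog -
          PowerSeries.C (algebraMap (v.adicCompletion K) (CompletedAlgClosure (v.adicCompletion K)) B) *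
            PowerSeries.expand p hprime.out.ne_zero (E₀.map (Int.castRingHom (CompletedAlgClosure (v.adicCompletion K)))).formalLog)‖ ≤ 1)
    (P : ((AinfTop.curveFO (v.adicCompletion K) (Wm.map ψm)).baseChange (v.adicCompletion K)).toAffine.Point)
    (Q : ℕ → geomPoints ((AinfTop.curveFO (v.adicCompletion K) (Wm.map ψm)).baseChange (v.adicCompletion K)))
    (hQ : ∀ n, p • Q (n + 1) = Q n)
    (hQ0 : Q 0 = toGeomPoints ((AinfTop.curveFO (v.adicCompletion K) (Wm.map ψm)).baseChange (v.adicCompletion K)) P)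
    (hP1 : AinfTop.geomToCO (Wm.map ψm) (Q 0) ∈ kernel (NormedField.valuation (K := CompletedAlgClosure (v.adicCompletion K)))
      (curveOver (CompletedAlgClosure (v.adicCompletion K)) (Wm.map ψm)))
    (huN : ‖((zPt (AinfTop.geomToCO (Wm.map ψm) (Q 0)) hP1 : CBall (v.adicCompletion K)) : CompletedAlgClosure (v.adicCompletion K))‖ ^ N ≤
      ‖(p : CompletedAlgClosure (v.adicCompletion K))‖)
    (cP : v.adicCompletion K)
    (hcP : algebraMap (v.adicCompletion K) (CompletedAlgClosure (v.adicCompletion K)) cP =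
      (p : CompletedAlgClosure (v.adicCompletion K)) ^ N *
        ∑' j : ℕ, PowerSeries.coeff j (Wm.map ((CBall (v.adicCompletion K)).subtype.comp (EisensteinRoot.CoeffDisc.toCBall Dv))).formalLog *
          ((zPt (AinfTop.geomToCO (Wm.map ψm) (Q 0)) hP1 : CBall (v.adicCompletion K)) : CompletedAlgClosure (v.adicCompletion K)) ^ j) :
    let em : (AinfTop.curveFO (v.adicCompletion K) (Wm.map ψm)).tateModule p ≃ₗ[ℤ_[p]] AinfTop.TatePtO (v.adicCompletion K) (Wm.map ψm) p :=
      (tateModuleEquiv (AinfTop.curveFO (v.adicCompletion K) (Wm.map ψm)) (v.adicCompletion K) p).trans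
        (AinfTop.tateGeomEquivTatePtOSS (v.adicCompletion K) (Wm.map ψm) p hp2 hΔ hA)
    let P₁ : (AinfTop.curveFO (v.adicCompletion K) (Wm.map ψm)).tateModule p →+ BdRPlusTop (v.adicCompletion K) p := P₀.comp em.toAddMonoidHom
    let Q₁ : (AinfTop.curveFO (v.adicCompletion K) (Wm.map ψm)).tateModule p →+ BdRPlusTop (v.adicCompletion K) p := Q₀.comp em.toAddMonoidHom
    ∃ (κ : contOneCocycles (restrictedTateRep (AinfTop.curveFO (v.adicCompletion K) (Wm.map ψm)) (v.adicCompletion K) p).toTopRep)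
      (bω₀ bη₀ : BdRPlusTop (v.adicCompletion K) p),
      (∀ j, (cohomologyMap (tateProjMor (AinfTop.curveFO (v.adicCompletion K) (Wm.map ψm)) (v.adicCompletion K) p j) 1).hom
          (oneCocycleClass _ κ) = kummerLevelClass (AinfTop.curveFO (v.adicCompletion K) (Wm.map ψm)) (v.adicCompletion K) p j P) ∧
      (∀ τ, P₁ (κ.1 τ) = BdRPlusTop.gal (v.adicCompletion K) p τ bω₀ - bω₀) ∧
      (∀ τ, Q₁ (κ.1 τ) = BdRPlusTop.gal (v.adicCompletion K) p τ bη₀ - bη₀) ∧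
      thetaBdR ((BdRPlusTop.of (v.adicCompletion K) p).symm
        (BdRPlusTop.of (v.adicCompletion K) p (embBdRHom hpv (surjective_fontaineTheta_integerC hpv) A) * bω₀ +
          BdRPlusTop.of (v.adicCompletion K) p (embBdRHom hpv (surjective_fontaineTheta_integerC hpv) B) * bη₀)) =
        algebraMap (v.adicCompletion K) (CompletedAlgClosure (v.adicCompletion K)) cP ∧
      ∀ a : (AinfTop.curveFO (v.adicCompletion K) (Wm.map ψm)).tateModule p, ∃ M : ℕ,
        IsTeichLog 2 ((BdRPlusTop.of (v.adicCompletion K) p).symm ((p : BdRPlusTop (v.adicCompletion K) p) ^ M *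
          (Q₁ a * bω₀ - P₁ a * bη₀))) := by
  intro em P₁ Q₁
  have hN1 : 1 ≤ N := Dv.e_pos.trans_le hN
  -- the `T`-adic Kummer cocycle of `P`, its level classes, and its image `κ_u` under `em`
  have hfix : ∀ σ : absoluteGaloisGroup (v.adicCompletion K), σ • Q 0 = Q 0 :=
    gal_smul_divSeq_zero (AinfTop.curveFO (v.adicCompletion K) (Wm.map ψm)) (v.adicCompletion K) hQ0
  have hker := AinfTop.geomToCO_divSeq_mem_kernel (Wm.map ψm) hp2 hΔ hA hQ hP1
  obtain ⟨κ, hκ⟩ := exists_contOneCocycles_tadicKummer (AinfTop.curveFO (v.adicCompletion K) (Wm.map ψm)) (v.adicCompletion K) p hQ hfix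
  have h1 := cohomologyMap_tateProjMor_oneCocycleClass_eq_kummerLevelClass (AinfTop.curveFO (v.adicCompletion K) (Wm.map ψm))
    (v.adicCompletion K) p hQ hQ0 κ hκ
  have hemκ : ∀ τ, em (κ.1 τ) =
      AinfRamTop.kummerCocycleO Wm ψm hψm (fun n => zPt (AinfTop.geomToCO (Wm.map ψm) (Q n)) (hker n))
        (AinfTop.mulPC_zPt_divSeqO Wm ψm hψm hQ hker) (AinfTop.galCBall_zPt_divSeqO_zero Wm ψm hfix hker) τ :=
    em_tadicKummer_eq_kummerCocycleO v hpv Dv Wm ψm hψm hp2 hΔ hA hQ hfix hker κ hκ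
  -- the Kummer tower `u = z(Q)` of `Ŵ_D(𝔪_ℂ)`, its CM-fibre transport `Tu`, depth and witness
  have hup := AinfTop.mulPC_zPt_divSeqO Wm ψm hψm hQ hker
  -- (the tower `u` is a lambda: pass it explicitly to the tower lemmas, whose `hup`-binders do not determine it by unification)
  obtain ⟨Tu, ⟨hTu, hTuv⟩, -⟩ := exists_unique_int_divisionSeq_of_ramified Dv Wm E₀ hWE
    (v := fun n => zPt (AinfTop.geomToCO (Wm.map ψm) (Q n)) (hker n)) hup
  have hdepth := norm_transport_zero_pow_le_of_norm_pow_le Dv (u := fun n => zPt (AinfTop.geomToCO (Wm.map ψm) (Q n)) (hker n))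
    (Tu := Tu) hTuv hN huN
  have hmem := AinfTop.pow_coe_val_nsmul_divisionLiftPt_mem E₀ (hθ := surjective_fontaineTheta_integerC hpv) (u := Tu) hTu hdepth 1
  rw [one_nsmul] at hmem
  obtain ⟨z, hz⟩ := exists_algebraMap_pow_eq_natCast_mul (F := (v.adicCompletion K)) (p := p) hmem
  -- the transported crystalline integrating pair `(b⁰_ω, b⁰_η) = (f Λ_{Tu}, f φΛ_{Tu})`
  obtain ⟨Λ, hΛdef⟩ : ∃ Λ' : BmaxPlus (v.adicCompletion K) p,
      Λ' = PadicLogSeries.logSum ((algebraMap (Ainf (p := p) (v.adicCompletion K)) (bmaxZero (v.adicCompletion K) p)).comp zpToAinf)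
        (GaloisContinuity.formalLogNum E₀ p) N
        (algebraMap (Ainf (p := p) (v.adicCompletion K)) (bmaxZero (v.adicCompletion K) p)
          ((AinfTop.of (v.adicCompletion K) p).symm (((AinfTop.divisionLiftPt E₀ (surjective_fontaineTheta_integerC hpv) Tu hTu).val :
            (AinfTop.nilTheta (v.adicCompletion K) p (surjective_fontaineTheta_integerC hpv)).toIdeal) : AinfTop (v.adicCompletion K) p))) z :=
    ⟨_, rfl⟩
  -- (the same element through `torsionLift`: `↑(divisionLiftPt …).val = torsionLift …` is `rfl`, `AinfTop.coe_val_divisionLiftPt`; T2c is stated with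
  -- `torsionLift`, and we keep its output untouched — rewriting inside these large statements is prohibitively slow)
  have hΛdef' : Λ = PadicLogSeries.logSum ((algebraMap (Ainf (p := p) (v.adicCompletion K)) (bmaxZero (v.adicCompletion K) p)).comp zpToAinf)
        (GaloisContinuity.formalLogNum E₀ p) N
        (algebraMap (Ainf (p := p) (v.adicCompletion K)) (bmaxZero (v.adicCompletion K) p)
          ((AinfTop.of (v.adicCompletion K) p).symm (AinfTop.torsionLift E₀ (surjective_fontaineTheta_integerC hpv) Tu hTu))) z := hΛdef
  have hpair := fun σ => transported_integrating_pair Dv Wm E₀ hWE ψm hψm (hθ := surjective_fontaineTheta_integerC hpv) hN hLT hP₀ hQ₀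
    (u := fun n => zPt (AinfTop.geomToCO (Wm.map ψm) (Q n)) (hker n)) hup (AinfTop.galCBall_zPt_divSeqO_zero Wm ψm hfix hker) huN
    (Tu := Tu) hTu hTuv hz σ
  have hHonda := AinfTop.frobBmaxPlus_hondaTrace_logSum_divisionLiftPt_eq_zero E₀ (hθ := surjective_fontaineTheta_integerC hpv) (u := Tu)
    hTu hN1 hz
  have hz' : algebraMap (Ainf (p := p) (v.adicCompletion K)) (bmaxZero (v.adicCompletion K) p)
      ((AinfTop.of (v.adicCompletion K) p).symm (AinfTop.torsionLift E₀ (surjective_fontaineTheta_integerC hpv) Tu hTu)) ^ N =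
      (p : bmaxZero (v.adicCompletion K) p) * z := by
    have h := hz
    rw [AinfTop.coe_val_divisionLiftPt] at h
    exact h
  have hθb := AinfRamTop.thetaBdR_transportedHodgeCombination_eq Dv (hθ := surjective_fontaineTheta_integerC hpv) Wm E₀ A B dHL hHL
    (fun n => zPt (AinfTop.geomToCO (Wm.map ψm) (Q n)) (hker n)) Tu hup hTu hTuv hN1 hz'
  refine ⟨κ, BdRPlusTop.of (v.adicCompletion K) p (bmaxPlusToBdR (v.adicCompletion K) p Λ),
    BdRPlusTop.of (v.adicCompletion K) p (bmaxPlusToBdR (v.adicCompletion K) p (frobBmaxPlus (v.adicCompletion K) p Λ)), h1,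
    fun τ => ?_, fun τ => ?_, ?_, fun a => ?_⟩
  · -- `P₁(κ τ) = τ b⁰_ω − b⁰_ω`
    -- (no `rw` inside the large integrating-pair statements: unfold the abbreviation `Λ` in the SMALL goal and close by `exact`)
    change P₀ (em (κ.1 τ)) = _
    rw [hemκ τ, hΛdef]
    exact (hpair τ).1
  · -- `Q₁(κ τ) = τ b⁰_η − b⁰_η`
    change Q₀ (em (κ.1 τ)) = _
    rw [hemκ τ, hΛdef]
    exact (hpair τ).2
  · -- `θ(ι(A) b⁰_ω + ι(B) b⁰_η) = p^N·log_{W_D}(z(P)) = ι(c_P)`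
    rw [map_add, map_mul, map_mul, RingEquiv.symm_apply_apply, RingEquiv.symm_apply_apply, RingEquiv.symm_apply_apply,
      RingEquiv.symm_apply_apply, hcP, hΛdef']
    exact hθb
  · -- (K₂) at `a`: PROVED (Dieudonné–Honda + fundamental exact sequence)
    obtain ⟨w, ⟨hw, hwv⟩, -⟩ := exists_unique_transport_seqO Dv Wm E₀ hWE ψm hψm (em a)
    change ∃ M : ℕ, IsTeichLog 2 ((BdRPlusTop.of (v.adicCompletion K) p).symm ((p : BdRPlusTop (v.adicCompletion K) p) ^ M *
      (Q₀ (em a) * BdRPlusTop.of (v.adicCompletion K) p (bmaxPlusToBdR (v.adicCompletion K) p Λ) -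
        P₀ (em a) * BdRPlusTop.of (v.adicCompletion K) p (bmaxPlusToBdR (v.adicCompletion K) p (frobBmaxPlus (v.adicCompletion K) p Λ)))))
    rw [hΛdef]
    exact isTeichLog_transported_resolution (D := Dv) (W := Wm) (E₀ := E₀) (ψ := ψm) (hθ := surjective_fontaineTheta_integerC hpv)
      (surjective_fontaineTheta_integerC hpv) hpv hN hLT hP₀ hQ₀ hHonda (em a) hw hwv (k := 2) (by norm_num)

end Completion

end Literature.NumberTheory.PAdicHodge

end
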